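import Literature.Analysis.InnerProduct.ClosedRangeTheoremHilbert
import HarnessLib

/-!
# Hörmander's functional analysis of a Hilbert complex `H₁ →T H₂ →S H₃`: closed range ⇔ the estimates
# (1.1.1)/(1.1.2) with the same best constant (Thm 1.1.1), `R_T` and `R_S` both closed ⇔ the basic estimate
# `‖g‖² ≤ C²(‖T*g‖² + ‖Sg‖²)` on `D_{T*} ∩ D_S ∩ N^⊥` (Thm 1.1.2), and compactness ⇒ the basic estimate and
# `dim N < ∞` (Thm 1.1.3) (L. Hörmander, Acta Math. 113 (1965), §1.1)

Layer `Literature/Analysis/InnerProduct`, namespace `Literature.Analysis.InnerProduct`; sequel BY NAME of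
`AdjointEstimateClosedRange.lean` (Hörmander's book Lemma 4.1.1 in both halves:
`exists_adjoint_estimate_of_range_eq`, `isClosed_range_adjoint_of_adjoint_estimate`), of
`ClosedRangeTheoremHilbert.lean` (Kato IV Thm 5.13: `isClosed_range_of_isClosed_range_adjoint`,
`isClosed_range_adjoint_of_isClosed_range`, `inf_sup_range_sup_range_adjoint_eq_top`) and of
`ClosedDenselyDefinedHilbertComplex.lean` (von Neumann / Demailly VIII Thm 1.1–1.2: `adjoint_adjoint_of_isClosed`,
`orthogonal_ker_eq_closure_range_adjoint`, `closure_range_le_ker`, `range_adjoint_le_pmapKer_adjoint`, the weak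
Hodge decomposition `inf_sup_closure_range_sup_closure_range_adjoint_eq_top` (1.1.5) and its orthogonalities).
Lane `lit-hodgefound` (Track 2 foundations library), prover seat `lit-hodgefound-p06` (generation 31),
self-proposed row g31-#7. THEOREMS ONLY (no definition, no named fact). Unbounded operators are Mathlib's
`LinearPMap` (`T : E →ₗ.[𝕜] F`, `T†` = `LinearPMap.adjoint`, `T.IsClosed`); `N_T = Ker T` is written
`(LinearMap.ker T.toFun).map T.domain.subtype`, `R_T = LinearMap.range T.toFun`, `[R_T]` = its
`topologicalClosure`, and Hörmander's `N = N_{T*} ∩ N_S` is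
`(LinearMap.ker S.toFun).map S.domain.subtype ⊓ (LinearMap.ker T†.toFun).map T†.domain.subtype`.

## Source, verbatim (L. Hörmander, *L² estimates and existence theorems for the ∂̄ operator*, Acta Math. 113
(1965), §1.1 pp. 91–93; held text `paper:doi-10-1007-bf02391775`, p0003–p0005)

"Let `H₁` and `H₂` be two Hilbert spaces and let `T : H₁ → H₂` be a linear, closed, densely defined operator.
Then `T* : H₂ → H₁` has the same properties, and `T** = T`. … By definition of the adjoint operator, the
orthogonal complement of the range `R_T` of `T` is the null space `N_{T*}` of `T*`, which implies that the
orthogonal complement of `N_{T*}` is the closure `[R_T]` of `R_T`. …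

THEOREM 1.1.1. The following conditions on `T` are equivalent: (a) `R_T` is closed. (b) There is a constant
`C` such that (1.1.1) `‖f‖₁ ≤ C‖Tf‖₂, f ∈ D_T ∩ [R_{T*}]`. (c) `R_{T*}` is closed. (d) There is a constant `C`
such that (1.1.2) `‖g‖₂ ≤ C‖T*g‖₁, g ∈ D_{T*} ∩ [R_T]`. The best constants in (1.1.1) and in (1.1.2) are the
same.

Proof. Assume that (a) holds. Since the orthogonal complement of `[R_{T*}]` is equal to `N_T`, the
restriction of `T` to `D_T ∩ [R_{T*}]` is a closed, one to one, linear mapping onto the closed subspace `R_T`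
of `H₂`. Hence the inverse is continuous by the closed graph theorem, which proves (b). Conversely, (b)
obviously implies (a). In view of the symmetry between `T` and `T*`, it is now clear that (c) and (d) are
also equivalent, and it suffices to prove that (b) implies (d). From (b) we obtain
`|(g, Tf)₂| = |(T*g, f)₁| ≤ ‖T*g‖₁‖f‖₁ ≤ C‖T*g‖₁‖Tf‖₂; g ∈ D_{T*}, f ∈ D_T ∩ [R_{T*}]`. Hence
`|(g, h)₂| ≤ C‖T*g‖₁‖h‖₂, g ∈ D_{T*}, h ∈ R_T`, which implies (d). …

we assume given another Hilbert space `H₃` and a closed densely defined linear operator `S : H₂ → H₃` such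
that (1.1.3) `ST = 0`. Then the range of `T` is of course included in the null space of `S`.

THEOREM 1.1.2. A necessary and sufficient condition for `R_T` and `R_S` both to be closed is that
(1.1.4) `‖g‖₂² ≤ C²(‖T*g‖₁² + ‖Sg‖₃²); g ∈ D_{T*} ∩ D_S, g ⊥ N = N_{T*} ∩ N_S`.

Proof. First note that (1.1.5) `H₂ = [R_T] ⊕ N ⊕ [R_{S*}]`, `N_S = N ⊕ [R_T]`. In fact, (1.1.3) implies that
`R_T` and `R_{S*}` are orthogonal, and the intersection of the orthogonal complements of these spaces is `N`.
Now `S` vanishes on `[R_T]`, and `T*` vanishes on `[R_{S*}]` since `T*S* = 0`. By (1.1.2) `R_T` is closed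
if and only if the inequality (1.1.4) is valid when `g ∈ D_{T*} ∩ [R_T]`. Similarly, by (1.1.1) with `T`
replaced by `S`, `R_S` is closed if and only if the inequality (1.1.4) is valid when `g ∈ D_S ∩ [R_{S*}]`.
Since every `g` occurring in (1.1.4) can be split into two such orthogonal components, the theorem follows.
Note that the dimension of `N` is equal to the codimension of `[R_T]` in `N_S` …

THEOREM 1.1.3. Assume that from every sequence `g_k ∈ D_{T*} ∩ D_S` with `‖g_k‖₂` bounded and `T*g_k → 0`
in `H₁`, `Sg_k → 0` in `H₃`, one can select a strongly convergent subsequence. Then (1.1.4) holds and `N` is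
finite dimensional.

Proof. By hypothesis the unit sphere in `N` is compact, so `N` has to be finite dimensional. Now if (1.1.4)
were not valid, we could choose a sequence `g_k ⊥ N` such that `‖g_k‖₂ = 1` and `T*g_k → 0` in `H₁`,
`Sg_k → 0` in `H₃`. Let `g` be a strong limit of the sequence `g_k`, which exists by hypothesis. Then
`‖g‖₂ = 1` and `g` is orthogonal to `N` although `T*g = Sg = 0`, so that `g ∈ N`. This contradiction proves
(1.1.4)."

## What is proved (all over `𝕜 = ℝ` or `ℂ`, i.e. `RCLike 𝕜`; Hörmander states complex Hilbert spaces)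

* §1 (Theorem 1.1.1, `T : E →ₗ.[𝕜] F` closed and densely defined): **`adjoint_estimate_of_estimate`** ((b)
  with constant `C` ⇒ (d) with the SAME `C` — the displayed computation), **`estimate_of_adjoint_estimate`**
  (the converse, "symmetry between `T` and `T*`", `T** = T`), `exists_adjoint_estimate_of_isClosed_range`
  ((a) ⇒ (d)), `exists_estimate_of_isClosed_range` ((a) ⇒ (b)), `isClosed_range_of_adjoint_estimate` ((d) ⇒ (a)),
  `isClosed_range_of_estimate_closure_range_adjoint` ((b) ⇒ (a)), and the equivalences **`isClosed_range_iff_exists_estimate`**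
  ((a) ⇔ (b)), **`isClosed_range_iff_exists_adjoint_estimate`** ((a) ⇔ (d)),
  `isClosed_range_adjoint_iff_exists_adjoint_estimate` ((c) ⇔ (d)); (a) ⇔ (c) is the tree's
  `isClosed_range_iff_isClosed_range_adjoint` (Kato IV 5.13).
* §2 (Theorem 1.1.2, `S : F →ₗ.[𝕜] G` closed densely defined with `R_T ⊆ N_S`):
  **`isClosed_range_of_basic_estimate`** (sufficiency: (1.1.4) on `D_{T*} ∩ D_S ∩ N^⊥` ⇒ `R_T` AND `R_S` closed),
  **`exists_basic_estimate_of_isClosed_range`** (necessity), **`isClosed_range_and_iff_exists_basic_estimate`**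
  (the theorem as printed), with the two halves of the proof `adjoint_estimate_of_basic_estimate` ((1.1.4) ⇒
  (1.1.2) for `T` with constant `|C|`) and `estimate_of_basic_estimate` ((1.1.4) ⇒ (1.1.1) for `S`); and the
  strong Hodge decomposition under (1.1.4), `harmonic_sup_range_sup_range_adjoint_eq_top_of_basic_estimate`
  (`H₂ = N ⊕ R_T ⊕ R_{S*}`, from the tree's closed-range form of (1.1.5)).
* §3 (Theorem 1.1.3): **`finiteDimensional_harmonic_of_seqCompact`** (`N` is finite dimensional) and
  **`exists_basic_estimate_of_seqCompact`** ((1.1.4) holds), hence `isClosed_range_of_seqCompact`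
  (`R_T`, `R_S` closed). The compactness hypothesis is stated sequentially, as printed.

Not formalised here: the remark "the dimension of `N` is equal to the codimension of `[R_T]` in `N_S`" (it is
the tree's `nonempty_linearEquiv_harmonic_quotient_closure_range`, file `HilbertComplexHarmonicCohomology`),
and Theorem 1.1.4 (the modified estimate with an auxiliary operator `A`).

## References

* [Hormander1965] L. Hörmander, *L² estimates and existence theorems for the ∂̄ operator*, Acta Math. 113
  (1965), 89–152, §1.1, Theorems 1.1.1–1.1.3, (1.1.1)–(1.1.5).
* [HormanderSCV1973] L. Hörmander, *An Introduction to Complex Analysis in Several Variables* (1973), §4.1,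
  Lemmas 4.1.1–4.1.2 (the estimates used, through `AdjointEstimateClosedRange.lean`).
* [Kato1966] T. Kato, *Perturbation Theory for Linear Operators* (1966), IV §5.2 Thm 5.13 ((a) ⇔ (c), through
  `ClosedRangeTheoremHilbert.lean`).
* [DemaillyAGBook] J.-P. Demailly, *Complex Analytic and Differential Geometry*, Ch. VIII §1 Thm 1.1–1.2 (the
  decompositions (1.1.5), through `ClosedDenselyDefinedHilbertComplex.lean`).
-/

noncomputable section

open scoped InnerProductSpace LinearPMap
open Filter Topology

namespace Literature.Analysis.InnerProduct

variable {𝕜 E F G : Type*} [RCLike 𝕜]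
variable [NormedAddCommGroup E] [InnerProductSpace 𝕜 E] [CompleteSpace E]
variable [NormedAddCommGroup F] [InnerProductSpace 𝕜 F] [CompleteSpace F]
variable [NormedAddCommGroup G] [InnerProductSpace 𝕜 G] [CompleteSpace G]

/-! ### §1 Theorem 1.1.1: closed range and the estimates (1.1.1), (1.1.2) -/

section Single

variable {T : E →ₗ.[𝕜] F}

/-- **Theorem 1.1.1, (b) ⇒ (d) with the same constant**: if `‖f‖ ≤ C‖Tf‖` for `f ∈ D_T ∩ [R_{T*}]`, then
`‖g‖ ≤ C‖T*g‖` for `g ∈ D_{T*} ∩ [R_T]` ("From (b) we obtain `|(g, Tf)| = |(T*g, f)| ≤ ‖T*g‖‖f‖ ≤ C‖T*g‖‖Tf‖`,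
`g ∈ D_{T*}`, `f ∈ D_T ∩ [R_{T*}]`. Hence `|(g, h)| ≤ C‖T*g‖‖h‖`, `g ∈ D_{T*}`, `h ∈ R_T`, which implies (d)";
every `h ∈ R_T` is `Tf` with `f ∈ D_T ∩ [R_{T*}] = D_T ∩ N_T^⊥` by subtracting the projection onto the closed
subspace `N_T ⊆ D_T`). [cite: Hormander1965, §1.1 Thm 1.1.1 (proof, "it suffices to prove that (b) implies (d)")] -/
theorem adjoint_estimate_of_estimate (hd : Dense (T.domain : Set E)) (hc : T.IsClosed) {C : ℝ} (hC : 0 ≤ C)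
    (hest : ∀ f : T.domain, (f : E) ∈ (LinearMap.range T†.toFun).topologicalClosure → ‖(f : E)‖ ≤ C * ‖T f‖)
    (g : T†.domain) (hg : (g : F) ∈ (LinearMap.range T.toFun).topologicalClosure) :
    ‖(g : F)‖ ≤ C * ‖T† g‖ := by
  -- `|(g, h)| ≤ C ‖T*g‖ ‖h‖` for `h = Tf₀ ∈ R_T`
  have key : ∀ f₀ : T.domain, ‖⟪(g : F), T f₀⟫_𝕜‖ ≤ C * ‖T† g‖ * ‖T f₀‖ := by
    intro f₀
    set K : Submodule 𝕜 E := (LinearMap.ker T.toFun).map T.domain.subtype with hK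
    haveI : CompleteSpace K := (isClosed_pmapKer hc).completeSpace_coe
    obtain ⟨hPdom, hP0⟩ := mem_pmapKer_iff.1 (K.starProjection_apply_mem (f₀ : E))
    set f : T.domain := ⟨(f₀ : E) - K.starProjection f₀, T.domain.sub_mem f₀.2 hPdom⟩ with hf
    have hTf : T f = T f₀ := by
      have hsplit : f = f₀ - ⟨K.starProjection f₀, hPdom⟩ := rfl
      rw [hsplit, LinearPMap.map_sub, hP0, sub_zero]
    have hfmem : (f : E) ∈ (LinearMap.range T†.toFun).topologicalClosure := by
      rw [← orthogonal_ker_eq_closure_range_adjoint hd hc]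
      exact K.sub_starProjection_mem_orthogonal (f₀ : E)
    have h1 : ⟪(g : F), T f₀⟫_𝕜 = ⟪T† g, (f : E)⟫_𝕜 := by
      rw [← hTf]
      exact ((LinearPMap.adjoint_isFormalAdjoint hd) g f).symm
    calc ‖⟪(g : F), T f₀⟫_𝕜‖ = ‖⟪T† g, (f : E)⟫_𝕜‖ := by rw [h1]
      _ ≤ ‖T† g‖ * ‖(f : E)‖ := norm_inner_le_norm _ _
      _ ≤ ‖T† g‖ * (C * ‖T f‖) := by gcongr; exact hest f hfmem
      _ = C * ‖T† g‖ * ‖T f₀‖ := by rw [hTf]; ring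
  have hsub : ((LinearMap.range T.toFun : Submodule 𝕜 F) : Set F) ⊆
      {h : F | ‖⟪(g : F), h⟫_𝕜‖ ≤ C * ‖T† g‖ * ‖h‖} := by
    rintro h ⟨f₀, rfl⟩
    exact key f₀
  -- pass to `h ∈ [R_T]`, in particular `h = g`
  have hclosed : IsClosed {h : F | ‖⟪(g : F), h⟫_𝕜‖ ≤ C * ‖T† g‖ * ‖h‖} :=
    isClosed_le (continuous_const.inner continuous_id).norm (continuous_const.mul continuous_norm)
  have hg' : (g : F) ∈ closure ((LinearMap.range T.toFun : Submodule 𝕜 F) : Set F) := by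
    rw [← Submodule.topologicalClosure_coe]; exact hg
  have h2 : ‖⟪(g : F), (g : F)⟫_𝕜‖ ≤ C * ‖T† g‖ * ‖(g : F)‖ := closure_minimal hsub hclosed hg'
  rw [← inner_self_re_eq_norm, inner_self_eq_norm_sq, pow_two] at h2
  by_cases h0 : ‖(g : F)‖ = 0
  · rw [h0]; positivity
  · exact le_of_mul_le_mul_right h2 (lt_of_le_of_ne (norm_nonneg _) (Ne.symm h0))

/-- **Theorem 1.1.1, (d) ⇒ (b) with the same constant** ("In view of the symmetry between `T` and `T*`":
the previous statement for `T*`, using `T** = T`). [cite: Hormander1965, §1.1 Thm 1.1.1 ("The best constants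
in (1.1.1) and in (1.1.2) are the same")] -/
theorem estimate_of_adjoint_estimate (hd : Dense (T.domain : Set E)) (hc : T.IsClosed) {C : ℝ} (hC : 0 ≤ C)
    (hadj : ∀ g : T†.domain, (g : F) ∈ (LinearMap.range T.toFun).topologicalClosure → ‖(g : F)‖ ≤ C * ‖T† g‖)
    (f : T.domain) (hf : (f : E) ∈ (LinearMap.range T†.toFun).topologicalClosure) :
    ‖(f : E)‖ ≤ C * ‖T f‖ := by
  have hd' := dense_adjoint_domain_of_isClosed hd hc
  have hc' : T†.IsClosed := LinearPMap.adjoint_isClosed hd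
  have hTT := adjoint_adjoint_of_isClosed hd hc
  have hadj' : ∀ g : T†.domain, (g : F) ∈ (LinearMap.range T††.toFun).topologicalClosure →
      ‖(g : F)‖ ≤ C * ‖T† g‖ := by
    rw [hTT]; exact hadj
  have key := adjoint_estimate_of_estimate hd' hc' hC hadj'
  rw [hTT] at key
  exact key f hf

/-- **Theorem 1.1.1, (a) ⇒ (d)**: if `R_T` is closed there is `C ≥ 0` with `‖g‖ ≤ C‖T*g‖` for
`g ∈ D_{T*} ∩ [R_T]` (Lemma 4.1.1 of Hörmander's book applied to the closed subspace `F = R_T = [R_T]`).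
[cite: Hormander1965, §1.1 Thm 1.1.1 (a) ⇒ (d)] -/
theorem exists_adjoint_estimate_of_isClosed_range (hd : Dense (T.domain : Set E))
    (hR : IsClosed ((LinearMap.range T.toFun : Submodule 𝕜 F) : Set F)) :
    ∃ C : ℝ, 0 ≤ C ∧ ∀ g : T†.domain, (g : F) ∈ (LinearMap.range T.toFun).topologicalClosure →
      ‖(g : F)‖ ≤ C * ‖T† g‖ := by
  obtain ⟨C, hC, hest⟩ := exists_adjoint_estimate_of_range_eq hd hR rfl
  refine ⟨C, hC, fun g hg ↦ hest g ?_⟩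
  rwa [hR.submodule_topologicalClosure_eq] at hg

/-- **Theorem 1.1.1, (a) ⇒ (b)**: if `R_T` is closed there is `C ≥ 0` with `‖f‖ ≤ C‖Tf‖` for
`f ∈ D_T ∩ [R_{T*}]` ("the restriction of `T` to `D_T ∩ [R_{T*}]` is a closed, one to one, linear mapping onto
the closed subspace `R_T` … Hence the inverse is continuous"; here: (a) ⇒ (d) ⇒ (b) with the same constant).
[cite: Hormander1965, §1.1 Thm 1.1.1 (a) ⇒ (b)] -/
theorem exists_estimate_of_isClosed_range (hd : Dense (T.domain : Set E)) (hc : T.IsClosed)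
    (hR : IsClosed ((LinearMap.range T.toFun : Submodule 𝕜 F) : Set F)) :
    ∃ C : ℝ, 0 ≤ C ∧ ∀ f : T.domain, (f : E) ∈ (LinearMap.range T†.toFun).topologicalClosure →
      ‖(f : E)‖ ≤ C * ‖T f‖ := by
  obtain ⟨C, hC, hadj⟩ := exists_adjoint_estimate_of_isClosed_range hd hR
  exact ⟨C, hC, estimate_of_adjoint_estimate hd hc hC hadj⟩

/-- **Theorem 1.1.1, (d) ⇒ (a)**: the estimate (1.1.2) on `D_{T*} ∩ [R_T]` makes `R_{T*}` closed (Lemma 4.1.2 of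
the book with `F = [R_T]`), hence `R_T` closed (Kato IV 5.13). [cite: Hormander1965, §1.1 Thm 1.1.1 (d) ⇒ (c) ⇒ (a)] -/
theorem isClosed_range_of_adjoint_estimate (hd : Dense (T.domain : Set E)) (hc : T.IsClosed) {C : ℝ}
    (hC : 0 ≤ C)
    (hadj : ∀ g : T†.domain, (g : F) ∈ (LinearMap.range T.toFun).topologicalClosure → ‖(g : F)‖ ≤ C * ‖T† g‖) :
    IsClosed ((LinearMap.range T.toFun : Submodule 𝕜 F) : Set F) := by
  have h1 : IsClosed ((LinearMap.range T†.toFun : Submodule 𝕜 E) : Set E) :=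
    isClosed_range_adjoint_of_adjoint_estimate hd (Submodule.isClosed_topologicalClosure _)
      (fun x ↦ Submodule.le_topologicalClosure _ (LinearMap.mem_range_self _ x)) hC hadj
  exact isClosed_range_of_isClosed_range_adjoint hd hc h1

/-- **Theorem 1.1.1, (b) ⇒ (a)** ("Conversely, (b) obviously implies (a)"; here through (b) ⇒ (d) ⇒ (a)).
[cite: Hormander1965, §1.1 Thm 1.1.1 (b) ⇒ (a)] -/
theorem isClosed_range_of_estimate_closure_range_adjoint (hd : Dense (T.domain : Set E)) (hc : T.IsClosed) {C : ℝ} (hC : 0 ≤ C)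
    (hest : ∀ f : T.domain, (f : E) ∈ (LinearMap.range T†.toFun).topologicalClosure → ‖(f : E)‖ ≤ C * ‖T f‖) :
    IsClosed ((LinearMap.range T.toFun : Submodule 𝕜 F) : Set F) :=
  isClosed_range_of_adjoint_estimate hd hc hC (adjoint_estimate_of_estimate hd hc hC hest)

/-- **Theorem 1.1.1, (a) ⇔ (b)**: `R_T` is closed iff `‖f‖ ≤ C‖Tf‖` on `D_T ∩ [R_{T*}]` for some constant `C`.
[cite: Hormander1965, §1.1 Thm 1.1.1 (a) ⇔ (b), (1.1.1)] -/
theorem isClosed_range_iff_exists_estimate (hd : Dense (T.domain : Set E)) (hc : T.IsClosed) :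
    IsClosed ((LinearMap.range T.toFun : Submodule 𝕜 F) : Set F) ↔
      ∃ C : ℝ, 0 ≤ C ∧ ∀ f : T.domain, (f : E) ∈ (LinearMap.range T†.toFun).topologicalClosure →
        ‖(f : E)‖ ≤ C * ‖T f‖ :=
  ⟨exists_estimate_of_isClosed_range hd hc, fun ⟨_, hC, hest⟩ ↦ isClosed_range_of_estimate_closure_range_adjoint hd hc hC hest⟩

/-- **Theorem 1.1.1, (a) ⇔ (d)**: `R_T` is closed iff `‖g‖ ≤ C‖T*g‖` on `D_{T*} ∩ [R_T]` for some constant `C`.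
[cite: Hormander1965, §1.1 Thm 1.1.1 (a) ⇔ (d), (1.1.2)] -/
theorem isClosed_range_iff_exists_adjoint_estimate (hd : Dense (T.domain : Set E)) (hc : T.IsClosed) :
    IsClosed ((LinearMap.range T.toFun : Submodule 𝕜 F) : Set F) ↔
      ∃ C : ℝ, 0 ≤ C ∧ ∀ g : T†.domain, (g : F) ∈ (LinearMap.range T.toFun).topologicalClosure →
        ‖(g : F)‖ ≤ C * ‖T† g‖ :=
  ⟨exists_adjoint_estimate_of_isClosed_range hd,
    fun ⟨_, hC, hadj⟩ ↦ isClosed_range_of_adjoint_estimate hd hc hC hadj⟩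

/-- **Theorem 1.1.1, (c) ⇔ (d)**: `R_{T*}` is closed iff (1.1.2) holds for some constant.
[cite: Hormander1965, §1.1 Thm 1.1.1 (c) ⇔ (d)] -/
theorem isClosed_range_adjoint_iff_exists_adjoint_estimate (hd : Dense (T.domain : Set E)) (hc : T.IsClosed) :
    IsClosed ((LinearMap.range T†.toFun : Submodule 𝕜 E) : Set E) ↔
      ∃ C : ℝ, 0 ≤ C ∧ ∀ g : T†.domain, (g : F) ∈ (LinearMap.range T.toFun).topologicalClosure →
        ‖(g : F)‖ ≤ C * ‖T† g‖ :=
  (isClosed_range_iff_isClosed_range_adjoint hd hc).symm.trans (isClosed_range_iff_exists_adjoint_estimate hd hc)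

end Single

/-! ### §2 Theorem 1.1.2: `R_T`, `R_S` both closed ⇔ the basic estimate (1.1.4) on `N^⊥` -/

section Complex

variable {T : E →ₗ.[𝕜] F} {S : F →ₗ.[𝕜] G}

/-- `a ≤ b` from `a² ≤ C² b²` for `a, b ≥ 0`, with the constant `|C|`. [folklore] -/
private theorem le_abs_mul_of_sq_le {a b C : ℝ} (ha : 0 ≤ a) (hb : 0 ≤ b) (h : a ^ 2 ≤ C ^ 2 * b ^ 2) :
    a ≤ |C| * b := by
  have h' : a ^ 2 ≤ (|C| * b) ^ 2 := by rwa [mul_pow, sq_abs]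
  exact (pow_le_pow_iff_left₀ ha (mul_nonneg (abs_nonneg C) hb) two_ne_zero).1 h'

omit [CompleteSpace F] [CompleteSpace G] in
/-- **Proof of Theorem 1.1.2, first half: (1.1.4) on `N^⊥` gives (1.1.2) for `T`** with constant `|C|` ("Now `S`
vanishes on `[R_T]` … By (1.1.2) `R_T` is closed if and only if the inequality (1.1.4) is valid when
`g ∈ D_{T*} ∩ [R_T]`": such `g` lie in `N_S ⊆ D_S` with `Sg = 0` and are orthogonal to `N`).
[cite: Hormander1965, §1.1 Thm 1.1.2 (proof)] -/
theorem adjoint_estimate_of_basic_estimate (hdT : Dense (T.domain : Set E)) (hcS : S.IsClosed)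
    (hST : LinearMap.range T.toFun ≤ (LinearMap.ker S.toFun).map S.domain.subtype) {C : ℝ}
    (h14 : ∀ (g : F) (hgT : g ∈ T†.domain) (hgS : g ∈ S.domain),
      g ∈ ((LinearMap.ker S.toFun).map S.domain.subtype ⊓ (LinearMap.ker T†.toFun).map T†.domain.subtype)ᗮ →
        ‖g‖ ^ 2 ≤ C ^ 2 * (‖T† ⟨g, hgT⟩‖ ^ 2 + ‖S ⟨g, hgS⟩‖ ^ 2))
    (g : T†.domain) (hg : (g : F) ∈ (LinearMap.range T.toFun).topologicalClosure) :
    ‖(g : F)‖ ≤ |C| * ‖T† g‖ := by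
  obtain ⟨hgS, hS0⟩ := mem_pmapKer_iff.1 (closure_range_le_ker hcS hST hg)
  have hN : (g : F) ∈ ((LinearMap.ker S.toFun).map S.domain.subtype ⊓
      (LinearMap.ker T†.toFun).map T†.domain.subtype)ᗮ := (isOrtho_inf_closure_range hdT).symm hg
  have h := h14 g g.2 hgS hN
  rw [hS0, norm_zero, zero_pow two_ne_zero, add_zero, Subtype.coe_eta] at h
  exact le_abs_mul_of_sq_le (norm_nonneg _) (norm_nonneg _) h

/-- **Proof of Theorem 1.1.2, second half: (1.1.4) on `N^⊥` gives (1.1.1) for `S`** with constant `|C|`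
("`T*` vanishes on `[R_{S*}]` since `T*S* = 0` … by (1.1.1) with `T` replaced by `S`, `R_S` is closed if and
only if the inequality (1.1.4) is valid when `g ∈ D_S ∩ [R_{S*}]`"). [cite: Hormander1965, §1.1 Thm 1.1.2 (proof)] -/
theorem estimate_of_basic_estimate (hdT : Dense (T.domain : Set E)) (hdS : Dense (S.domain : Set F))
    (hcS : S.IsClosed) (hST : LinearMap.range T.toFun ≤ (LinearMap.ker S.toFun).map S.domain.subtype) {C : ℝ}
    (h14 : ∀ (g : F) (hgT : g ∈ T†.domain) (hgS : g ∈ S.domain),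
      g ∈ ((LinearMap.ker S.toFun).map S.domain.subtype ⊓ (LinearMap.ker T†.toFun).map T†.domain.subtype)ᗮ →
        ‖g‖ ^ 2 ≤ C ^ 2 * (‖T† ⟨g, hgT⟩‖ ^ 2 + ‖S ⟨g, hgS⟩‖ ^ 2))
    (f : S.domain) (hf : (f : F) ∈ (LinearMap.range S†.toFun).topologicalClosure) :
    ‖(f : F)‖ ≤ |C| * ‖S f‖ := by
  have hle : (LinearMap.range S†.toFun).topologicalClosure ≤ (LinearMap.ker T†.toFun).map T†.domain.subtype :=
    Submodule.topologicalClosure_minimal _ (range_adjoint_le_pmapKer_adjoint hdS hST)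
      (isClosed_pmapKer (LinearPMap.adjoint_isClosed hdT))
  obtain ⟨hfT, hT0⟩ := mem_pmapKer_iff.1 (hle hf)
  have hN : (f : F) ∈ ((LinearMap.ker S.toFun).map S.domain.subtype ⊓
      (LinearMap.ker T†.toFun).map T†.domain.subtype)ᗮ := (isOrtho_inf_closure_range_adjoint hdS hcS).symm hf
  have h := h14 f hfT f.2 hN
  rw [hT0, norm_zero, zero_pow two_ne_zero, zero_add, Subtype.coe_eta] at h
  exact le_abs_mul_of_sq_le (norm_nonneg _) (norm_nonneg _) h

/-- **Theorem 1.1.2, sufficiency: the basic estimate (1.1.4) `‖g‖² ≤ C²(‖T*g‖² + ‖Sg‖²)` for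
`g ∈ D_{T*} ∩ D_S`, `g ⊥ N`, implies that `R_T` and `R_S` are both closed.**
[cite: Hormander1965, §1.1 Thm 1.1.2] -/
theorem isClosed_range_of_basic_estimate (hdT : Dense (T.domain : Set E)) (hcT : T.IsClosed)
    (hdS : Dense (S.domain : Set F)) (hcS : S.IsClosed)
    (hST : LinearMap.range T.toFun ≤ (LinearMap.ker S.toFun).map S.domain.subtype) {C : ℝ}
    (h14 : ∀ (g : F) (hgT : g ∈ T†.domain) (hgS : g ∈ S.domain),
      g ∈ ((LinearMap.ker S.toFun).map S.domain.subtype ⊓ (LinearMap.ker T†.toFun).map T†.domain.subtype)ᗮ →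
        ‖g‖ ^ 2 ≤ C ^ 2 * (‖T† ⟨g, hgT⟩‖ ^ 2 + ‖S ⟨g, hgS⟩‖ ^ 2)) :
    IsClosed ((LinearMap.range T.toFun : Submodule 𝕜 F) : Set F) ∧
      IsClosed ((LinearMap.range S.toFun : Submodule 𝕜 G) : Set G) :=
  ⟨isClosed_range_of_adjoint_estimate hdT hcT (abs_nonneg C) (adjoint_estimate_of_basic_estimate hdT hcS hST h14),
    isClosed_range_of_estimate_closure_range_adjoint hdS hcS (abs_nonneg C) (estimate_of_basic_estimate hdT hdS hcS hST h14)⟩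

/-- **Theorem 1.1.2, necessity: if `R_T` and `R_S` are both closed, the basic estimate (1.1.4) holds on
`D_{T*} ∩ D_S ∩ N^⊥`** ("Since every `g` occurring in (1.1.4) can be split into two such orthogonal components":
`g = a + b`, `a ∈ [R_T]` where `Sa = 0` and (1.1.2) bounds `‖a‖ ≤ C₁‖T*a‖ = C₁‖T*g‖`, `b ∈ [R_{S*}]` where
`T*b = 0` and (1.1.1) for `S` bounds `‖b‖ ≤ C₂‖Sb‖ = C₂‖Sg‖`; `C = max(C₁, C₂)`).
[cite: Hormander1965, §1.1 Thm 1.1.2] -/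
theorem exists_basic_estimate_of_isClosed_range (hdT : Dense (T.domain : Set E))
    (hdS : Dense (S.domain : Set F)) (hcS : S.IsClosed)
    (hST : LinearMap.range T.toFun ≤ (LinearMap.ker S.toFun).map S.domain.subtype)
    (hRT : IsClosed ((LinearMap.range T.toFun : Submodule 𝕜 F) : Set F))
    (hRS : IsClosed ((LinearMap.range S.toFun : Submodule 𝕜 G) : Set G)) :
    ∃ C : ℝ, 0 ≤ C ∧ ∀ (g : F) (hgT : g ∈ T†.domain) (hgS : g ∈ S.domain),
      g ∈ ((LinearMap.ker S.toFun).map S.domain.subtype ⊓ (LinearMap.ker T†.toFun).map T†.domain.subtype)ᗮ →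
        ‖g‖ ^ 2 ≤ C ^ 2 * (‖T† ⟨g, hgT⟩‖ ^ 2 + ‖S ⟨g, hgS⟩‖ ^ 2) := by
  obtain ⟨C₁, hC₁, h1⟩ := exists_adjoint_estimate_of_isClosed_range hdT hRT
  obtain ⟨C₂, hC₂, h2⟩ := exists_estimate_of_isClosed_range hdS hcS hRS
  refine ⟨max C₁ C₂, le_max_of_le_left hC₁, fun g hgT hgS hN ↦ ?_⟩
  -- (1.1.5): `g = n + a + b` with `n ∈ N`, `a ∈ [R_T]`, `b ∈ [R_{S*}]`; `n = 0` because `g ⊥ N`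
  have htop := inf_sup_closure_range_sup_closure_range_adjoint_eq_top (T := T) (S := S) hdT hdS hcS hST
  have hg : g ∈ ((LinearMap.ker S.toFun).map S.domain.subtype ⊓ (LinearMap.ker T†.toFun).map T†.domain.subtype) ⊔
      (LinearMap.range T.toFun).topologicalClosure ⊔ (LinearMap.range S†.toFun).topologicalClosure := by
    rw [htop]; exact Submodule.mem_top
  obtain ⟨y, hy, b, hb, hyb⟩ := Submodule.mem_sup.1 hg
  obtain ⟨n, hn, a, ha, hna⟩ := Submodule.mem_sup.1 hy
  have hn_a : ⟪n, a⟫_𝕜 = 0 := (isOrtho_inf_closure_range hdT).inner_eq hn ha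
  have hn_b : ⟪n, b⟫_𝕜 = 0 := (isOrtho_inf_closure_range_adjoint hdS hcS).inner_eq hn hb
  have hn_g : ⟪n, g⟫_𝕜 = 0 := (Submodule.mem_orthogonal _ _).1 hN n hn
  have hgsum : g = n + a + b := by rw [← hyb, ← hna]
  have hn0 : n = 0 := by
    rw [hgsum, inner_add_right, inner_add_right, hn_a, hn_b, add_zero, add_zero] at hn_g
    exact inner_self_eq_zero.1 hn_g
  rw [hn0, zero_add] at hgsum
  -- `a ∈ [R_T] ⊆ N_S`, `b ∈ [R_{S*}] ⊆ N_{T*}`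
  obtain ⟨haS, hSa⟩ := mem_pmapKer_iff.1 (closure_range_le_ker hcS hST ha)
  have hle : (LinearMap.range S†.toFun).topologicalClosure ≤ (LinearMap.ker T†.toFun).map T†.domain.subtype :=
    Submodule.topologicalClosure_minimal _ (range_adjoint_le_pmapKer_adjoint hdS hST)
      (isClosed_pmapKer (LinearPMap.adjoint_isClosed hdT))
  obtain ⟨hbT, hTb⟩ := mem_pmapKer_iff.1 (hle hb)
  have ha_eq : a = g - b := eq_sub_of_add_eq hgsum.symm
  have hb_eq : b = g - a := eq_sub_of_add_eq' hgsum.symm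
  have haT : a ∈ T†.domain := by rw [ha_eq]; exact T†.domain.sub_mem hgT hbT
  have hbS : b ∈ S.domain := by rw [hb_eq]; exact S.domain.sub_mem hgS haS
  have hTa : T† ⟨a, haT⟩ = T† ⟨g, hgT⟩ := by
    have h := LinearPMap.map_sub T† ⟨g, hgT⟩ ⟨b, hbT⟩
    rw [hTb, sub_zero] at h
    rw [← h]
    congr 1
    exact Subtype.ext ha_eq
  have hSb : S ⟨b, hbS⟩ = S ⟨g, hgS⟩ := by
    have h := LinearPMap.map_sub S ⟨g, hgS⟩ ⟨a, haS⟩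
    rw [hSa, sub_zero] at h
    rw [← h]
    congr 1
    exact Subtype.ext hb_eq
  -- the two one-sided estimates and Pythagoras
  have hea : ‖a‖ ≤ C₁ * ‖T† ⟨g, hgT⟩‖ := hTa ▸ h1 ⟨a, haT⟩ ha
  have heb : ‖b‖ ≤ C₂ * ‖S ⟨g, hgS⟩‖ := hSb ▸ h2 ⟨b, hbS⟩ hb
  have hab : ⟪a, b⟫_𝕜 = 0 := (isOrtho_closure_range_closure_range_adjoint hdS hcS hST).inner_eq ha hb
  have hpyth : ‖g‖ ^ 2 = ‖a‖ ^ 2 + ‖b‖ ^ 2 := by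
    rw [hgsum, pow_two, pow_two, pow_two]
    exact norm_add_sq_eq_norm_sq_add_norm_sq_of_inner_eq_zero a b hab
  have hT0 : 0 ≤ ‖T† ⟨g, hgT⟩‖ := norm_nonneg _
  have hS0 : 0 ≤ ‖S ⟨g, hgS⟩‖ := norm_nonneg _
  have hCa : C₁ ^ 2 ≤ (max C₁ C₂) ^ 2 := pow_le_pow_left₀ hC₁ (le_max_left _ _) 2
  have hCb : C₂ ^ 2 ≤ (max C₁ C₂) ^ 2 := pow_le_pow_left₀ hC₂ (le_max_right _ _) 2
  calc ‖g‖ ^ 2 = ‖a‖ ^ 2 + ‖b‖ ^ 2 := hpyth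
    _ ≤ (C₁ * ‖T† ⟨g, hgT⟩‖) ^ 2 + (C₂ * ‖S ⟨g, hgS⟩‖) ^ 2 :=
        add_le_add (pow_le_pow_left₀ (norm_nonneg _) hea 2) (pow_le_pow_left₀ (norm_nonneg _) heb 2)
    _ = C₁ ^ 2 * ‖T† ⟨g, hgT⟩‖ ^ 2 + C₂ ^ 2 * ‖S ⟨g, hgS⟩‖ ^ 2 := by rw [mul_pow, mul_pow]
    _ ≤ (max C₁ C₂) ^ 2 * ‖T† ⟨g, hgT⟩‖ ^ 2 + (max C₁ C₂) ^ 2 * ‖S ⟨g, hgS⟩‖ ^ 2 :=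
        add_le_add (mul_le_mul_of_nonneg_right hCa (sq_nonneg _)) (mul_le_mul_of_nonneg_right hCb (sq_nonneg _))
    _ = (max C₁ C₂) ^ 2 * (‖T† ⟨g, hgT⟩‖ ^ 2 + ‖S ⟨g, hgS⟩‖ ^ 2) := by rw [mul_add]

/-- **Theorem 1.1.2 (as printed): `R_T` and `R_S` are both closed if and only if the basic estimate (1.1.4)
holds for some constant.** [cite: Hormander1965, §1.1 Thm 1.1.2] -/
theorem isClosed_range_and_iff_exists_basic_estimate (hdT : Dense (T.domain : Set E)) (hcT : T.IsClosed)
    (hdS : Dense (S.domain : Set F)) (hcS : S.IsClosed)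
    (hST : LinearMap.range T.toFun ≤ (LinearMap.ker S.toFun).map S.domain.subtype) :
    (IsClosed ((LinearMap.range T.toFun : Submodule 𝕜 F) : Set F) ∧
      IsClosed ((LinearMap.range S.toFun : Submodule 𝕜 G) : Set G)) ↔
      ∃ C : ℝ, 0 ≤ C ∧ ∀ (g : F) (hgT : g ∈ T†.domain) (hgS : g ∈ S.domain),
        g ∈ ((LinearMap.ker S.toFun).map S.domain.subtype ⊓ (LinearMap.ker T†.toFun).map T†.domain.subtype)ᗮ →
          ‖g‖ ^ 2 ≤ C ^ 2 * (‖T† ⟨g, hgT⟩‖ ^ 2 + ‖S ⟨g, hgS⟩‖ ^ 2) :=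
  ⟨fun h ↦ exists_basic_estimate_of_isClosed_range hdT hdS hcS hST h.1 h.2,
    fun ⟨_, _, h14⟩ ↦ isClosed_range_of_basic_estimate hdT hcT hdS hcS hST h14⟩

/-- **The strong Hodge decomposition under the basic estimate: `H₂ = N ⊕ R_T ⊕ R_{S*}`** ((1.1.5) with the closed
ranges `[R_T] = R_T`, `[R_{S*}] = R_{S*}` given by Theorem 1.1.2 and Theorem 1.1.1 (c)).
[cite: Hormander1965, §1.1 Thm 1.1.2 with (1.1.5)] -/
theorem harmonic_sup_range_sup_range_adjoint_eq_top_of_basic_estimate (hdT : Dense (T.domain : Set E))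
    (hcT : T.IsClosed) (hdS : Dense (S.domain : Set F)) (hcS : S.IsClosed)
    (hST : LinearMap.range T.toFun ≤ (LinearMap.ker S.toFun).map S.domain.subtype) {C : ℝ}
    (h14 : ∀ (g : F) (hgT : g ∈ T†.domain) (hgS : g ∈ S.domain),
      g ∈ ((LinearMap.ker S.toFun).map S.domain.subtype ⊓ (LinearMap.ker T†.toFun).map T†.domain.subtype)ᗮ →
        ‖g‖ ^ 2 ≤ C ^ 2 * (‖T† ⟨g, hgT⟩‖ ^ 2 + ‖S ⟨g, hgS⟩‖ ^ 2)) :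
    ((LinearMap.ker S.toFun).map S.domain.subtype ⊓ (LinearMap.ker T†.toFun).map T†.domain.subtype) ⊔
        LinearMap.range T.toFun ⊔ LinearMap.range S†.toFun = ⊤ := by
  obtain ⟨hRT, hRS⟩ := isClosed_range_of_basic_estimate hdT hcT hdS hcS hST h14
  exact inf_sup_range_sup_range_adjoint_eq_top hdT hdS hcS hST hRT hRS

end Complex

/-! ### §3 Theorem 1.1.3: compactness gives the basic estimate and `dim N < ∞` -/

section Compact

variable {T : E →ₗ.[𝕜] F} {S : F →ₗ.[𝕜] G}

omit [CompleteSpace F] [CompleteSpace G] in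
/-- **Theorem 1.1.3, first conclusion: under the compactness hypothesis, `N = N_{T*} ∩ N_S` is finite
dimensional** ("By hypothesis the unit sphere in `N` is compact, so `N` has to be finite dimensional": a sequence
in the unit ball of `N` has `T*g_k = 0`, `Sg_k = 0`, so it has a convergent subsequence, whose limit stays in the
closed subspace `N`; Riesz). [cite: Hormander1965, §1.1 Thm 1.1.3] -/
theorem finiteDimensional_harmonic_of_seqCompact (hdT : Dense (T.domain : Set E)) (hcS : S.IsClosed)
    (hcpt : ∀ (g : ℕ → F) (hgT : ∀ k, g k ∈ T†.domain) (hgS : ∀ k, g k ∈ S.domain),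
      (∃ M : ℝ, ∀ k, ‖g k‖ ≤ M) → Tendsto (fun k ↦ T† ⟨g k, hgT k⟩) atTop (𝓝 0) →
      Tendsto (fun k ↦ S ⟨g k, hgS k⟩) atTop (𝓝 0) →
      ∃ g₀ : F, ∃ φ : ℕ → ℕ, StrictMono φ ∧ Tendsto (g ∘ φ) atTop (𝓝 g₀)) :
    FiniteDimensional 𝕜
      ↥((LinearMap.ker S.toFun).map S.domain.subtype ⊓ (LinearMap.ker T†.toFun).map T†.domain.subtype) := by
  set N : Submodule 𝕜 F :=
    (LinearMap.ker S.toFun).map S.domain.subtype ⊓ (LinearMap.ker T†.toFun).map T†.domain.subtype with hN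
  have hNc : IsClosed (N : Set F) := by
    rw [hN, Submodule.coe_inf]
    exact (isClosed_pmapKer hcS).inter (isClosed_pmapKer (LinearPMap.adjoint_isClosed hdT))
  refine FiniteDimensional.of_isCompact_closedBall₀ 𝕜 zero_lt_one ?_
  rw [isCompact_iff_isSeqCompact]
  intro x hx
  have hmem : ∀ k, ((x k : N) : F) ∈ N := fun k ↦ (x k).2
  have hT : ∀ k, ∃ h : ((x k : N) : F) ∈ T†.domain, T† ⟨(x k : F), h⟩ = 0 := fun k ↦
    mem_pmapKer_iff.1 (Submodule.mem_inf.1 (hmem k)).2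
  have hS : ∀ k, ∃ h : ((x k : N) : F) ∈ S.domain, S ⟨(x k : F), h⟩ = 0 := fun k ↦
    mem_pmapKer_iff.1 (Submodule.mem_inf.1 (hmem k)).1
  choose hgT hT0 using hT
  choose hgS hS0 using hS
  have hbd : ∀ k, ‖((x k : N) : F)‖ ≤ 1 := fun k ↦ by
    rw [← Submodule.coe_norm]; exact mem_closedBall_zero_iff.1 (hx k)
  obtain ⟨g₀, φ, hφ, hlim⟩ := hcpt (fun k ↦ (x k : F)) hgT hgS ⟨1, hbd⟩
    (by simp_rw [hT0]; exact tendsto_const_nhds) (by simp_rw [hS0]; exact tendsto_const_nhds)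
  have hg₀N : g₀ ∈ N := hNc.mem_of_tendsto hlim (Eventually.of_forall fun k ↦ hmem (φ k))
  have hg₀1 : ‖g₀‖ ≤ 1 := le_of_tendsto' hlim.norm fun k ↦ hbd (φ k)
  refine ⟨⟨g₀, hg₀N⟩, mem_closedBall_zero_iff.2 (by rw [Submodule.coe_norm]; exact hg₀1), φ, hφ, ?_⟩
  rw [tendsto_subtype_rng]
  exact hlim

omit [CompleteSpace F] [CompleteSpace G] in
/-- **Theorem 1.1.3, second conclusion: under the compactness hypothesis the basic estimate (1.1.4) holds**
("if (1.1.4) were not valid, we could choose a sequence `g_k ⊥ N` such that `‖g_k‖ = 1` and `T*g_k → 0`,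
`Sg_k → 0`. Let `g` be a strong limit … Then `‖g‖ = 1` and `g` is orthogonal to `N` although `T*g = Sg = 0`
[by the closedness of `T*` and `S`], so that `g ∈ N`. This contradiction proves (1.1.4)").
[cite: Hormander1965, §1.1 Thm 1.1.3] -/
theorem exists_basic_estimate_of_seqCompact (hdT : Dense (T.domain : Set E)) (hcS : S.IsClosed)
    (hcpt : ∀ (g : ℕ → F) (hgT : ∀ k, g k ∈ T†.domain) (hgS : ∀ k, g k ∈ S.domain),
      (∃ M : ℝ, ∀ k, ‖g k‖ ≤ M) → Tendsto (fun k ↦ T† ⟨g k, hgT k⟩) atTop (𝓝 0) →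
      Tendsto (fun k ↦ S ⟨g k, hgS k⟩) atTop (𝓝 0) →
      ∃ g₀ : F, ∃ φ : ℕ → ℕ, StrictMono φ ∧ Tendsto (g ∘ φ) atTop (𝓝 g₀)) :
    ∃ C : ℝ, 0 ≤ C ∧ ∀ (g : F) (hgT : g ∈ T†.domain) (hgS : g ∈ S.domain),
      g ∈ ((LinearMap.ker S.toFun).map S.domain.subtype ⊓ (LinearMap.ker T†.toFun).map T†.domain.subtype)ᗮ →
        ‖g‖ ^ 2 ≤ C ^ 2 * (‖T† ⟨g, hgT⟩‖ ^ 2 + ‖S ⟨g, hgS⟩‖ ^ 2) := by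
  set N : Submodule 𝕜 F :=
    (LinearMap.ker S.toFun).map S.domain.subtype ⊓ (LinearMap.ker T†.toFun).map T†.domain.subtype with hN
  by_contra hcon
  push Not at hcon
  -- a normalised violating sequence: `g_k ⊥ N`, `‖g_k‖ = 1`, `‖T*g_k‖² + ‖Sg_k‖² < 1/(k+1)²`
  have hk : ∀ k : ℕ, ∃ (g : F) (hgT : g ∈ T†.domain) (hgS : g ∈ S.domain), g ∈ Nᗮ ∧ ‖g‖ = 1 ∧
      ‖T† ⟨g, hgT⟩‖ ^ 2 + ‖S ⟨g, hgS⟩‖ ^ 2 < 1 / ((k : ℝ) + 1) ^ 2 := by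
    intro k
    obtain ⟨g, hgT, hgS, hgN, hlt⟩ := hcon ((k : ℝ) + 1) (by positivity)
    have hr : 0 < ‖g‖ := by
      rcases (norm_nonneg g).eq_or_lt with h | h
      · exfalso
        have h0 : ((k : ℝ) + 1) ^ 2 * (‖T† ⟨g, hgT⟩‖ ^ 2 + ‖S ⟨g, hgS⟩‖ ^ 2) < 0 := by
          rw [← h, zero_pow two_ne_zero] at hlt; exact hlt
        exact (lt_irrefl (0 : ℝ)) ((by positivity : (0 : ℝ) ≤ _).trans_lt h0)
      · exact h
    set c : 𝕜 := ((‖g‖⁻¹ : ℝ) : 𝕜) with hc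
    have hnc : ‖c‖ = ‖g‖⁻¹ := by rw [hc, RCLike.norm_ofReal, abs_of_pos (inv_pos.2 hr)]
    refine ⟨c • g, T†.domain.smul_mem c hgT, S.domain.smul_mem c hgS, Nᗮ.smul_mem c hgN, ?_, ?_⟩
    · rw [norm_smul, hnc, inv_mul_cancel₀ hr.ne']
    · have hTu : T† ⟨c • g, T†.domain.smul_mem c hgT⟩ = c • T† ⟨g, hgT⟩ := by
        rw [← LinearPMap.map_smul]; rfl
      have hSu : S ⟨c • g, S.domain.smul_mem c hgS⟩ = c • S ⟨g, hgS⟩ := by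
        rw [← LinearPMap.map_smul]; rfl
      rw [hTu, hSu, norm_smul, norm_smul, hnc, mul_pow, mul_pow, ← mul_add, inv_pow, inv_mul_eq_div,
        div_lt_div_iff₀ (pow_pos hr 2) (by positivity), one_mul, mul_comm]
      exact hlt
  choose g hgT hgS hgN hnorm hsmall using hk
  -- `T*g_k → 0`, `Sg_k → 0`, `‖g_k‖` bounded
  have hsmallT : ∀ k, ‖T† ⟨g k, hgT k⟩‖ ≤ 1 / ((k : ℝ) + 1) := fun k ↦ by
    refine (pow_le_pow_iff_left₀ (norm_nonneg _) (by positivity) two_ne_zero).1 ?_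
    have := hsmall k
    rw [div_pow, one_pow]
    nlinarith [sq_nonneg ‖S ⟨g k, hgS k⟩‖]
  have hsmallS : ∀ k, ‖S ⟨g k, hgS k⟩‖ ≤ 1 / ((k : ℝ) + 1) := fun k ↦ by
    refine (pow_le_pow_iff_left₀ (norm_nonneg _) (by positivity) two_ne_zero).1 ?_
    have := hsmall k
    rw [div_pow, one_pow]
    nlinarith [sq_nonneg ‖T† ⟨g k, hgT k⟩‖]
  have hT0 : Tendsto (fun k ↦ T† ⟨g k, hgT k⟩) atTop (𝓝 0) := by
    rw [tendsto_zero_iff_norm_tendsto_zero]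
    exact squeeze_zero (fun k ↦ norm_nonneg _) hsmallT tendsto_one_div_add_atTop_nhds_zero_nat
  have hS0 : Tendsto (fun k ↦ S ⟨g k, hgS k⟩) atTop (𝓝 0) := by
    rw [tendsto_zero_iff_norm_tendsto_zero]
    exact squeeze_zero (fun k ↦ norm_nonneg _) hsmallS tendsto_one_div_add_atTop_nhds_zero_nat
  obtain ⟨g₀, φ, hφ, hlim⟩ := hcpt g hgT hgS ⟨1, fun k ↦ (hnorm k).le⟩ hT0 hS0
  -- the limit: `‖g₀‖ = 1`, `g₀ ⊥ N`, and `T*g₀ = 0`, `Sg₀ = 0` by closedness of the graphs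
  have hg₀norm : ‖g₀‖ = 1 := by
    have h1 : Tendsto (fun k ↦ ‖(g ∘ φ) k‖) atTop (𝓝 1) := by
      simp_rw [Function.comp, hnorm]; exact tendsto_const_nhds
    exact tendsto_nhds_unique hlim.norm h1
  have hg₀N : g₀ ∈ Nᗮ := (Submodule.isClosed_orthogonal N).mem_of_tendsto hlim (Eventually.of_forall fun k ↦ hgN (φ k))
  have hgraphT : (g₀, (0 : E)) ∈ (T†.graph : Set (F × E)) :=
    (LinearPMap.adjoint_isClosed hdT).mem_of_tendsto (hlim.prodMk_nhds (hT0.comp hφ.tendsto_atTop))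
      (Eventually.of_forall fun k ↦ T†.mem_graph ⟨g (φ k), hgT (φ k)⟩)
  have hgraphS : (g₀, (0 : G)) ∈ (S.graph : Set (F × G)) :=
    hcS.mem_of_tendsto (hlim.prodMk_nhds (hS0.comp hφ.tendsto_atTop))
      (Eventually.of_forall fun k ↦ S.mem_graph ⟨g (φ k), hgS (φ k)⟩)
  obtain ⟨yT, hyT1, hyT2⟩ := (LinearPMap.mem_graph_iff _).1 hgraphT
  obtain ⟨yS, hyS1, hyS2⟩ := (LinearPMap.mem_graph_iff _).1 hgraphS
  dsimp only at hyT1 hyT2 hyS1 hyS2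
  have hg₀T : g₀ ∈ (LinearMap.ker T†.toFun).map T†.domain.subtype :=
    mem_pmapKer_iff.2 ⟨hyT1 ▸ yT.2, by rw [show (⟨g₀, hyT1 ▸ yT.2⟩ : T†.domain) = yT from Subtype.ext hyT1.symm]; exact hyT2⟩
  have hg₀S : g₀ ∈ (LinearMap.ker S.toFun).map S.domain.subtype :=
    mem_pmapKer_iff.2 ⟨hyS1 ▸ yS.2, by rw [show (⟨g₀, hyS1 ▸ yS.2⟩ : S.domain) = yS from Subtype.ext hyS1.symm]; exact hyS2⟩
  have hg₀inN : g₀ ∈ N := Submodule.mem_inf.2 ⟨hg₀S, hg₀T⟩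
  have h00 : ⟪g₀, g₀⟫_𝕜 = 0 := (Submodule.mem_orthogonal _ _).1 hg₀N g₀ hg₀inN
  have hz : g₀ = 0 := inner_self_eq_zero.1 h00
  rw [hz, norm_zero] at hg₀norm
  exact zero_ne_one hg₀norm

/-- **Theorem 1.1.3 with Theorem 1.1.2: under the compactness hypothesis `R_T` and `R_S` are closed** (and `N` is
finite dimensional: `finiteDimensional_harmonic_of_seqCompact`). [cite: Hormander1965, §1.1 Thms 1.1.2–1.1.3] -/
theorem isClosed_range_of_seqCompact (hdT : Dense (T.domain : Set E)) (hcT : T.IsClosed)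
    (hdS : Dense (S.domain : Set F)) (hcS : S.IsClosed)
    (hST : LinearMap.range T.toFun ≤ (LinearMap.ker S.toFun).map S.domain.subtype)
    (hcpt : ∀ (g : ℕ → F) (hgT : ∀ k, g k ∈ T†.domain) (hgS : ∀ k, g k ∈ S.domain),
      (∃ M : ℝ, ∀ k, ‖g k‖ ≤ M) → Tendsto (fun k ↦ T† ⟨g k, hgT k⟩) atTop (𝓝 0) →
      Tendsto (fun k ↦ S ⟨g k, hgS k⟩) atTop (𝓝 0) →
      ∃ g₀ : F, ∃ φ : ℕ → ℕ, StrictMono φ ∧ Tendsto (g ∘ φ) atTop (𝓝 g₀)) :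
    IsClosed ((LinearMap.range T.toFun : Submodule 𝕜 F) : Set F) ∧
      IsClosed ((LinearMap.range S.toFun : Submodule 𝕜 G) : Set G) := by
  obtain ⟨C, _, h14⟩ := exists_basic_estimate_of_seqCompact hdT hcS hcpt
  exact isClosed_range_of_basic_estimate hdT hcT hdS hcS hST h14

end Compact

end Literature.Analysis.InnerProduct
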